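import Summits.NavierStokesRegularity.NavierStokesRegularity.Theorems.EulerZoomLiouvillePowerGaugeEulerLiouvilleNeedleDiscChart

/-!
# The orthographic sphere chart (plate S1 of ROUND-36 «the needle's price, sphere by sphere»)

For an orthonormal frame `(e, e₁, e₂)` of `ℝ³` and a radius `t`, `sphereChart e e₁ e₂ t z := discChart (capHeight t z • e) e₁ e₂ z`
(`capHeight t z = √(t² − ‖z‖²)`) parametrises the hemisphere `{‖y‖ = t, ⟪y, e⟫ ≥ 0}` over the disc `‖z‖ ≤ t`
(orthographic projection). Pure chart calculus in the pattern of `…NeedleDiscChart` (t36c): `norm_sphereChart`;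
`hasFDerivAt_sphereChart` with `sphereChartDeriv = discChartL e₁ e₂ + capHeightDeriv ⊗ e` and the distortion bound
`‖sphereChartDeriv‖ ≤ t / capHeight t z`; the radial-flux observable `z ↦ ⟪sphereChart z, V (sphereChart z)⟫`, its derivative
`sphereFluxDeriv`, the bound `‖sphereFluxDeriv‖ ≤ (t / capHeight)(‖V y‖ + t‖V'‖)` and continuity on the open disc;
`sphereChart_transverseCoord` (surjectivity onto the closed hemisphere); `exists_inner_sq_ge` (six-cone cover).
No Euler content. [folklore: chain rule, orthographic projection]
-/

set_option linter.dupNamespace false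
open scoped RealInnerProductSpace

namespace Summit.NavierStokesRegularity.NavierStokesRegularity.Theorems.PowerGaugeEulerLiouville.NeedleSphereChart

open NeedleDiscChart

/-! ## The cap height `√(t² − ‖z‖²)` -/

/-- The height of the sphere of radius `t` above the transversal coordinate `z`: `√(t² − ‖z‖²)`. -/
noncomputable def capHeight (t : ℝ) (z : ℂ) : ℝ := Real.sqrt (t ^ 2 - ‖z‖ ^ 2)

/-- The cap height is non-negative. [folklore] -/
theorem capHeight_nonneg (t : ℝ) (z : ℂ) : 0 ≤ capHeight t z := Real.sqrt_nonneg _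

/-- `capHeight t z ^ 2 = t² − ‖z‖²` on the closed disc `‖z‖ ≤ t`. [folklore] -/
theorem capHeight_sq {t : ℝ} {z : ℂ} (hz : ‖z‖ ≤ t) : capHeight t z ^ 2 = t ^ 2 - ‖z‖ ^ 2 := by
  rw [capHeight, Real.sq_sqrt (by nlinarith [norm_nonneg z])]

/-- The cap height is positive on the open disc `‖z‖ < t`. [folklore] -/
theorem capHeight_pos {t : ℝ} {z : ℂ} (hz : ‖z‖ < t) : 0 < capHeight t z :=
  Real.sqrt_pos.2 (by nlinarith [norm_nonneg z])

/-- The cap height is at most the radius. [folklore] -/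
theorem capHeight_le {t : ℝ} (ht : 0 ≤ t) (z : ℂ) : capHeight t z ≤ t := by
  rw [capHeight, ← Real.sqrt_sq ht]
  exact Real.sqrt_le_sqrt (by rw [Real.sq_sqrt (sq_nonneg t)]; nlinarith [norm_nonneg z])

/-- At the centre the cap height is the radius. [folklore] -/
theorem capHeight_zero {t : ℝ} (ht : 0 ≤ t) : capHeight t 0 = t := by
  rw [capHeight, norm_zero]; simp [Real.sqrt_sq ht]

/-- Lower bound for the cap height on a smaller disc: `‖z‖ ≤ r` gives `√(t² − r²) ≤ capHeight t z`. [folklore] -/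
theorem sqrt_le_capHeight {t r : ℝ} {z : ℂ} (hz : ‖z‖ ≤ r) : Real.sqrt (t ^ 2 - r ^ 2) ≤ capHeight t z :=
  Real.sqrt_le_sqrt (by nlinarith [norm_nonneg z])

/-- The cap height is continuous in `z`. [folklore] -/
theorem continuous_capHeight (t : ℝ) : Continuous (capHeight t) :=
  Real.continuous_sqrt.comp (continuous_const.sub (continuous_norm.pow 2))

/-- The derivative of the cap height at `z` (open disc): `h ↦ −⟪z, h⟫ / capHeight t z`. -/
noncomputable def capHeightDeriv (t : ℝ) (z : ℂ) : ℂ →L[ℝ] ℝ := (-(capHeight t z)⁻¹) • innerSL ℝ z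

/-- Evaluation of the cap-height derivative. [folklore] -/
theorem capHeightDeriv_apply (t : ℝ) (z h : ℂ) : capHeightDeriv t z h = -(capHeight t z)⁻¹ * ⟪z, h⟫ := by
  simp [capHeightDeriv, innerSL_apply_apply]

/-- The cap height is differentiable on the open disc with derivative `capHeightDeriv`. [folklore: chain rule] -/
theorem hasFDerivAt_capHeight {t : ℝ} {z : ℂ} (hz : ‖z‖ < t) : HasFDerivAt (capHeight t) (capHeightDeriv t z) z := by
  have hpos : 0 < t ^ 2 - ‖z‖ ^ 2 := by nlinarith [norm_nonneg z]
  have h1 : HasFDerivAt (fun w : ℂ => t ^ 2 - ‖w‖ ^ 2) (-(2 • innerSL ℝ z)) z := by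
    have := (hasStrictFDerivAt_norm_sq z).hasFDerivAt
    simpa using this.const_sub (t ^ 2)
  have h2 := h1.sqrt hpos.ne'
  refine h2.congr_fderiv ?_
  ext h
  have hs : Real.sqrt (t ^ 2 - ‖z‖ ^ 2) ≠ 0 := (Real.sqrt_pos.2 hpos).ne'
  rw [capHeightDeriv_apply, capHeight]
  simp [innerSL_apply_apply]
  field_simp

/-- Bound on the cap-height derivative: `|capHeightDeriv t z h| ≤ ‖z‖ ‖h‖ / capHeight t z`. [folklore: Cauchy–Schwarz] -/
theorem norm_capHeightDeriv_apply_le {t : ℝ} {z : ℂ} (hz : ‖z‖ < t) (h : ℂ) :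
    ‖capHeightDeriv t z h‖ ≤ ‖z‖ * ‖h‖ / capHeight t z := by
  have hs := capHeight_pos hz
  rw [capHeightDeriv_apply, Real.norm_eq_abs, abs_mul, abs_neg, abs_inv, abs_of_pos hs]
  rw [inv_mul_eq_div]
  exact div_le_div_of_nonneg_right (abs_real_inner_le_norm z h) hs.le

/-! ## The chart -/

/-- The orthographic sphere chart: `z ↦ (re z) e₁ + (im z) e₂ + √(t² − ‖z‖²) e`. -/
noncomputable def sphereChart (e e₁ e₂ : (EuclideanSpace ℝ (Fin 3))) (t : ℝ) (z : ℂ) : (EuclideanSpace ℝ (Fin 3)) :=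
  discChart (capHeight t z • e) e₁ e₂ z

/-- The chart is a disc chart with moving centre `capHeight t z • e`. [definition unfolding] -/
theorem sphereChart_eq (e e₁ e₂ : (EuclideanSpace ℝ (Fin 3))) (t : ℝ) (z : ℂ) :
    sphereChart e e₁ e₂ t z = capHeight t z • e + discChartL e₁ e₂ z := by
  rw [sphereChart, discChart_eq]

/-- The chart is continuous. [folklore] -/
theorem continuous_sphereChart (e e₁ e₂ : (EuclideanSpace ℝ (Fin 3))) (t : ℝ) : Continuous (sphereChart e e₁ e₂ t) := by
  have h : sphereChart e e₁ e₂ t = fun z => capHeight t z • e + discChartL e₁ e₂ z := by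
    funext z; rw [sphereChart_eq]
  rw [h]
  exact ((continuous_capHeight t).smul continuous_const).add (discChartL e₁ e₂).continuous

section Frame

variable {e e₁ e₂ : (EuclideanSpace ℝ (Fin 3))}

/-- The chart lands on the sphere of radius `t`: `‖sphereChart e e₁ e₂ t z‖ = t` for `‖z‖ ≤ t`, `0 ≤ t`.
[folklore: Pythagoras] -/
theorem norm_sphereChart (he : ‖e‖ = 1) (h₁ : ‖e₁‖ = 1) (h₂ : ‖e₂‖ = 1) (he1 : ⟪e, e₁⟫ = 0) (he2 : ⟪e, e₂⟫ = 0)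
    (h12 : ⟪e₁, e₂⟫ = 0) {t : ℝ} (ht : 0 ≤ t) {z : ℂ} (hz : ‖z‖ ≤ t) : ‖sphereChart e e₁ e₂ t z‖ = t := by
  have hc1 : ⟪capHeight t z • e, e₁⟫ = 0 := by rw [real_inner_smul_left, he1, mul_zero]
  have hc2 : ⟪capHeight t z • e, e₂⟫ = 0 := by rw [real_inner_smul_left, he2, mul_zero]
  have hsq : ‖sphereChart e e₁ e₂ t z‖ ^ 2 = t ^ 2 := by
    rw [sphereChart, norm_discChart_sq h₁ h₂ h12 hc1 hc2, norm_smul, he, mul_one, Real.norm_eq_abs,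
      sq_abs, capHeight_sq hz]
    ring
  have h := (pow_left_inj₀ (norm_nonneg _) ht two_ne_zero).mp hsq
  exact h

/-- The `e`-coordinate of the chart point is the cap height. [folklore] -/
theorem inner_sphereChart_left (he : ‖e‖ = 1) (he1 : ⟪e, e₁⟫ = 0) (he2 : ⟪e, e₂⟫ = 0) (t : ℝ) (z : ℂ) :
    ⟪sphereChart e e₁ e₂ t z, e⟫ = capHeight t z := by
  rw [sphereChart_eq, inner_add_left, real_inner_smul_left, real_inner_self_eq_norm_sq, he, discChartL_apply,
    inner_add_left, real_inner_smul_left, real_inner_smul_left, real_inner_comm e e₁, real_inner_comm e e₂, he1, he2]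
  ring

/-- The centre of the chart is the pole `t • e`. [folklore] -/
theorem sphereChart_zero (e e₁ e₂ : (EuclideanSpace ℝ (Fin 3))) {t : ℝ} (ht : 0 ≤ t) :
    sphereChart e e₁ e₂ t 0 = t • e := by rw [sphereChart_eq, capHeight_zero ht, map_zero, add_zero]

/-- The derivative of the chart at `z`: `h ↦ discChartL e₁ e₂ h + (capHeightDeriv t z h) • e`. -/
noncomputable def sphereChartDeriv (e e₁ e₂ : (EuclideanSpace ℝ (Fin 3))) (t : ℝ) (z : ℂ) : ℂ →L[ℝ] (EuclideanSpace ℝ (Fin 3)) :=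
  discChartL e₁ e₂ + (capHeightDeriv t z).smulRight e

/-- Evaluation of the chart derivative. [folklore] -/
theorem sphereChartDeriv_apply (e e₁ e₂ : (EuclideanSpace ℝ (Fin 3))) (t : ℝ) (z h : ℂ) :
    sphereChartDeriv e e₁ e₂ t z h = discChartL e₁ e₂ h + (capHeightDeriv t z h) • e := by
  simp [sphereChartDeriv, ContinuousLinearMap.smulRight_apply]

/-- The chart is differentiable on the open disc with derivative `sphereChartDeriv`. [folklore: chain rule] -/
theorem hasFDerivAt_sphereChart (e e₁ e₂ : (EuclideanSpace ℝ (Fin 3))) {t : ℝ} {z : ℂ} (hz : ‖z‖ < t) :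
    HasFDerivAt (sphereChart e e₁ e₂ t) (sphereChartDeriv e e₁ e₂ t z) z := by
  have h : sphereChart e e₁ e₂ t = fun z => capHeight t z • e + discChartL e₁ e₂ z := by
    funext z; rw [sphereChart_eq]
  rw [h]
  have h1 : HasFDerivAt (fun w => capHeight t w • e) ((capHeightDeriv t z).smulRight e) z :=
    (hasFDerivAt_capHeight hz).smul_const e
  have h2 := h1.add (discChartL e₁ e₂).hasFDerivAt
  refine h2.congr_fderiv ?_
  ext h
  simp [sphereChartDeriv, add_comm]

/-- DISTORTION of the orthographic chart: `‖sphereChartDeriv e e₁ e₂ t z h‖ ≤ (t / capHeight t z) ‖h‖`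
(orthonormal frame, open disc). [folklore: the differential has singular values 1 and t/√(t²−‖z‖²)] -/
theorem norm_sphereChartDeriv_apply_le (he : ‖e‖ = 1) (h₁ : ‖e₁‖ = 1) (h₂ : ‖e₂‖ = 1) (he1 : ⟪e, e₁⟫ = 0)
    (he2 : ⟪e, e₂⟫ = 0) (h12 : ⟪e₁, e₂⟫ = 0) {t : ℝ} {z : ℂ} (hz : ‖z‖ < t) (h : ℂ) :
    ‖sphereChartDeriv e e₁ e₂ t z h‖ ≤ t / capHeight t z * ‖h‖ := by
  have hs := capHeight_pos hz
  have ht : 0 < t := lt_of_le_of_lt (norm_nonneg z) hz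
  set a : ℝ := capHeightDeriv t z h with ha
  have hL : ‖discChartL e₁ e₂ h‖ = ‖h‖ := norm_discChartL_apply h₁ h₂ h12 h
  have horth : ⟪discChartL e₁ e₂ h, e⟫ = 0 := by
    rw [discChartL_apply, inner_add_left, real_inner_smul_left, real_inner_smul_left, real_inner_comm e e₁,
      real_inner_comm e e₂, he1, he2]
    ring
  -- ‖D h‖² = ‖h‖² + a²
  have hsq : ‖sphereChartDeriv e e₁ e₂ t z h‖ ^ 2 = ‖h‖ ^ 2 + a ^ 2 := by
    rw [sphereChartDeriv_apply, ← ha, ← real_inner_self_eq_norm_sq, inner_add_left, inner_add_right,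
      inner_add_right, real_inner_smul_left, real_inner_smul_right, real_inner_smul_left, real_inner_smul_right,
      real_inner_comm (discChartL e₁ e₂ h) e, horth, real_inner_self_eq_norm_sq, real_inner_self_eq_norm_sq, hL, he]
    ring
  -- a² ≤ ‖z‖² ‖h‖² / s²
  have hab : |a| ≤ ‖z‖ * ‖h‖ / capHeight t z := by
    have := norm_capHeightDeriv_apply_le hz h
    rwa [Real.norm_eq_abs] at this
  have hs2 : capHeight t z ^ 2 = t ^ 2 - ‖z‖ ^ 2 := capHeight_sq hz.le
  have hbound : ‖sphereChartDeriv e e₁ e₂ t z h‖ ^ 2 ≤ (t / capHeight t z * ‖h‖) ^ 2 := by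
    rw [hsq]
    have ha2 : a ^ 2 ≤ (‖z‖ * ‖h‖ / capHeight t z) ^ 2 := by
      rw [← sq_abs a]
      exact pow_le_pow_left₀ (abs_nonneg a) hab 2
    have key : ‖h‖ ^ 2 + (‖z‖ * ‖h‖ / capHeight t z) ^ 2 = (t / capHeight t z * ‖h‖) ^ 2 := by
      field_simp
      rw [hs2]
      ring
    linarith [key]
  have hnn : 0 ≤ t / capHeight t z * ‖h‖ := by positivity
  exact (pow_le_pow_iff_left₀ (norm_nonneg _) hnn two_ne_zero).mp hbound

/-- Operator-norm form of the distortion bound. [folklore] -/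
theorem opNorm_sphereChartDeriv_le (he : ‖e‖ = 1) (h₁ : ‖e₁‖ = 1) (h₂ : ‖e₂‖ = 1) (he1 : ⟪e, e₁⟫ = 0)
    (he2 : ⟪e, e₂⟫ = 0) (h12 : ⟪e₁, e₂⟫ = 0) {t : ℝ} {z : ℂ} (hz : ‖z‖ < t) :
    ‖sphereChartDeriv e e₁ e₂ t z‖ ≤ t / capHeight t z :=
  ContinuousLinearMap.opNorm_le_bound _ (div_nonneg (le_of_lt (lt_of_le_of_lt (norm_nonneg z) hz)) (capHeight_nonneg t z))
    fun h => norm_sphereChartDeriv_apply_le he h₁ h₂ he1 he2 h12 hz h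

/-- Uniform distortion on a smaller disc: for `‖z‖ ≤ r < t`, `‖sphereChartDeriv … z‖ ≤ t / √(t² − r²)`. [folklore] -/
theorem opNorm_sphereChartDeriv_le_of_le (he : ‖e‖ = 1) (h₁ : ‖e₁‖ = 1) (h₂ : ‖e₂‖ = 1) (he1 : ⟪e, e₁⟫ = 0)
    (he2 : ⟪e, e₂⟫ = 0) (h12 : ⟪e₁, e₂⟫ = 0) {t r : ℝ} (hr : r < t) {z : ℂ} (hz : ‖z‖ ≤ r) :
    ‖sphereChartDeriv e e₁ e₂ t z‖ ≤ t / Real.sqrt (t ^ 2 - r ^ 2) := by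
  have hzt : ‖z‖ < t := lt_of_le_of_lt hz hr
  have ht : 0 < t := lt_of_le_of_lt (norm_nonneg z) hzt
  have hr0 : 0 ≤ r := le_trans (norm_nonneg z) hz
  have hsr : 0 < Real.sqrt (t ^ 2 - r ^ 2) := Real.sqrt_pos.2 (by nlinarith)
  calc ‖sphereChartDeriv e e₁ e₂ t z‖ ≤ t / capHeight t z := opNorm_sphereChartDeriv_le he h₁ h₂ he1 he2 h12 hzt
    _ ≤ t / Real.sqrt (t ^ 2 - r ^ 2) := div_le_div_of_nonneg_left ht.le hsr (sqrt_le_capHeight hz)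

/-- LIPSCHITZ bound of the chart on a smaller closed disc: `‖Φ z − Φ z'‖ ≤ (t/√(t²−r²)) ‖z − z'‖` for
`‖z‖, ‖z'‖ ≤ r < t`. [folklore: mean value inequality on a convex set] -/
theorem norm_sphereChart_sub_le (he : ‖e‖ = 1) (h₁ : ‖e₁‖ = 1) (h₂ : ‖e₂‖ = 1) (he1 : ⟪e, e₁⟫ = 0)
    (he2 : ⟪e, e₂⟫ = 0) (h12 : ⟪e₁, e₂⟫ = 0) {t r : ℝ} (hr : r < t) {z z' : ℂ} (hz : ‖z‖ ≤ r) (hz' : ‖z'‖ ≤ r) :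
    ‖sphereChart e e₁ e₂ t z - sphereChart e e₁ e₂ t z'‖ ≤ t / Real.sqrt (t ^ 2 - r ^ 2) * ‖z - z'‖ := by
  have hconv : Convex ℝ (Metric.closedBall (0 : ℂ) r) := convex_closedBall 0 r
  have hderiv : ∀ w ∈ Metric.closedBall (0 : ℂ) r,
      HasFDerivWithinAt (sphereChart e e₁ e₂ t) (sphereChartDeriv e e₁ e₂ t w) (Metric.closedBall (0 : ℂ) r) w :=
    fun w hw => (hasFDerivAt_sphereChart e e₁ e₂
      (lt_of_le_of_lt (mem_closedBall_zero_iff.mp hw) hr)).hasFDerivWithinAt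
  have hbound : ∀ w ∈ Metric.closedBall (0 : ℂ) r, ‖sphereChartDeriv e e₁ e₂ t w‖ ≤ t / Real.sqrt (t ^ 2 - r ^ 2) :=
    fun w hw => opNorm_sphereChartDeriv_le_of_le he h₁ h₂ he1 he2 h12 hr (mem_closedBall_zero_iff.mp hw)
  exact hconv.norm_image_sub_le_of_norm_hasFDerivWithin_le hderiv hbound (mem_closedBall_zero_iff.mpr hz')
    (mem_closedBall_zero_iff.mpr hz)

/-! ## The radial-flux observable on the sphere chart -/

/-- The derivative of the flux observable `z ↦ ⟪Φ z, V (Φ z)⟫` on the sphere chart: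
`h ↦ ⟪D h, V y⟫ + ⟪y, V' (D h)⟫`, `y = Φ z`, `D = sphereChartDeriv`. -/
noncomputable def sphereFluxDeriv (e e₁ e₂ : (EuclideanSpace ℝ (Fin 3))) (t : ℝ) (z : ℂ) (Vy : (EuclideanSpace ℝ (Fin 3)))
    (V' : (EuclideanSpace ℝ (Fin 3)) →L[ℝ] (EuclideanSpace ℝ (Fin 3))) : ℂ →L[ℝ] ℝ :=
  (innerSL ℝ Vy).comp (sphereChartDeriv e e₁ e₂ t z) +
    (innerSL ℝ (sphereChart e e₁ e₂ t z)).comp (V'.comp (sphereChartDeriv e e₁ e₂ t z))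

/-- Evaluation of the flux derivative. [folklore] -/
theorem sphereFluxDeriv_apply (e e₁ e₂ : (EuclideanSpace ℝ (Fin 3))) (t : ℝ) (z : ℂ) (Vy : (EuclideanSpace ℝ (Fin 3)))
    (V' : (EuclideanSpace ℝ (Fin 3)) →L[ℝ] (EuclideanSpace ℝ (Fin 3))) (h : ℂ) :
    sphereFluxDeriv e e₁ e₂ t z Vy V' h =
      ⟪Vy, sphereChartDeriv e e₁ e₂ t z h⟫ + ⟪sphereChart e e₁ e₂ t z, V' (sphereChartDeriv e e₁ e₂ t z h)⟫ := by
  simp [sphereFluxDeriv, innerSL_apply_apply]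

/-- The flux observable on the sphere chart has derivative `sphereFluxDeriv`. [folklore: product rule] -/
theorem hasFDerivAt_sphereFlux {V : (EuclideanSpace ℝ (Fin 3)) → (EuclideanSpace ℝ (Fin 3))}
    {V' : (EuclideanSpace ℝ (Fin 3)) →L[ℝ] (EuclideanSpace ℝ (Fin 3))} (e e₁ e₂ : (EuclideanSpace ℝ (Fin 3))) {t : ℝ} {z : ℂ}
    (hz : ‖z‖ < t) (hV : HasFDerivAt V V' (sphereChart e e₁ e₂ t z)) :
    HasFDerivAt (fun z => ⟪sphereChart e e₁ e₂ t z, V (sphereChart e e₁ e₂ t z)⟫)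
      (sphereFluxDeriv e e₁ e₂ t z (V (sphereChart e e₁ e₂ t z)) V') z := by
  have hφ := hasFDerivAt_sphereChart e e₁ e₂ hz
  have hVφ : HasFDerivAt (fun z => V (sphereChart e e₁ e₂ t z)) (V'.comp (sphereChartDeriv e e₁ e₂ t z)) z :=
    hV.comp z hφ
  have h := hφ.inner ℝ hVφ
  refine h.congr_fderiv ?_
  ext h'
  simp only [sphereFluxDeriv_apply, ContinuousLinearMap.comp_apply, ContinuousLinearMap.prod_apply,
    fderivInnerCLM_apply]
  rw [real_inner_comm (V (sphereChart e e₁ e₂ t z)) (sphereChartDeriv e e₁ e₂ t z h'), add_comm]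

/-- `‖f'‖ ≤ (t / capHeight t z)(‖V y‖ + t ‖V'‖)` for the flux observable at `y = Φ z` (orthonormal frame,
`‖z‖ < t`). [folklore] -/
theorem norm_sphereFluxDeriv_le (he : ‖e‖ = 1) (h₁ : ‖e₁‖ = 1) (h₂ : ‖e₂‖ = 1) (he1 : ⟪e, e₁⟫ = 0)
    (he2 : ⟪e, e₂⟫ = 0) (h12 : ⟪e₁, e₂⟫ = 0) {t : ℝ} {z : ℂ} (hz : ‖z‖ < t) (Vy : (EuclideanSpace ℝ (Fin 3)))
    (V' : (EuclideanSpace ℝ (Fin 3)) →L[ℝ] (EuclideanSpace ℝ (Fin 3))) :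
    ‖sphereFluxDeriv e e₁ e₂ t z Vy V'‖ ≤ t / capHeight t z * (‖Vy‖ + t * ‖V'‖) := by
  have ht : 0 < t := lt_of_le_of_lt (norm_nonneg z) hz
  have hK : 0 ≤ t / capHeight t z := div_nonneg ht.le (capHeight_nonneg t z)
  have hy : ‖sphereChart e e₁ e₂ t z‖ = t := norm_sphereChart he h₁ h₂ he1 he2 h12 ht.le hz.le
  refine ContinuousLinearMap.opNorm_le_bound _ (by positivity) fun h => ?_
  rw [sphereFluxDeriv_apply, Real.norm_eq_abs]
  have hD : ‖sphereChartDeriv e e₁ e₂ t z h‖ ≤ t / capHeight t z * ‖h‖ :=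
    norm_sphereChartDeriv_apply_le he h₁ h₂ he1 he2 h12 hz h
  calc |⟪Vy, sphereChartDeriv e e₁ e₂ t z h⟫ + ⟪sphereChart e e₁ e₂ t z, V' (sphereChartDeriv e e₁ e₂ t z h)⟫|
      ≤ |⟪Vy, sphereChartDeriv e e₁ e₂ t z h⟫| + |⟪sphereChart e e₁ e₂ t z, V' (sphereChartDeriv e e₁ e₂ t z h)⟫| :=
        abs_add_le _ _
    _ ≤ ‖Vy‖ * ‖sphereChartDeriv e e₁ e₂ t z h‖ + ‖sphereChart e e₁ e₂ t z‖ * ‖V' (sphereChartDeriv e e₁ e₂ t z h)‖ :=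
        add_le_add (abs_real_inner_le_norm _ _) (abs_real_inner_le_norm _ _)
    _ ≤ ‖Vy‖ * (t / capHeight t z * ‖h‖) + t * (‖V'‖ * (t / capHeight t z * ‖h‖)) := by
        rw [hy]
        gcongr
        exact (V'.le_opNorm _).trans (by gcongr)
    _ = t / capHeight t z * (‖Vy‖ + t * ‖V'‖) * ‖h‖ := by ring

/-- Squared form: `‖f'‖² ≤ (t / capHeight t z)² (2‖V y‖² + 2 t² ‖V'‖²)`. [folklore] -/
theorem norm_sphereFluxDeriv_sq_le (he : ‖e‖ = 1) (h₁ : ‖e₁‖ = 1) (h₂ : ‖e₂‖ = 1) (he1 : ⟪e, e₁⟫ = 0)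
    (he2 : ⟪e, e₂⟫ = 0) (h12 : ⟪e₁, e₂⟫ = 0) {t : ℝ} {z : ℂ} (hz : ‖z‖ < t) (Vy : (EuclideanSpace ℝ (Fin 3)))
    (V' : (EuclideanSpace ℝ (Fin 3)) →L[ℝ] (EuclideanSpace ℝ (Fin 3))) :
    ‖sphereFluxDeriv e e₁ e₂ t z Vy V'‖ ^ 2 ≤ (t / capHeight t z) ^ 2 * (2 * ‖Vy‖ ^ 2 + 2 * (t * ‖V'‖) ^ 2) := by
  have h := norm_sphereFluxDeriv_le he h₁ h₂ he1 he2 h12 hz Vy V'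
  have h0 : 0 ≤ ‖sphereFluxDeriv e e₁ e₂ t z Vy V'‖ := norm_nonneg _
  have hK : 0 ≤ t / capHeight t z := div_nonneg (le_of_lt (lt_of_le_of_lt (norm_nonneg z) hz)) (capHeight_nonneg t z)
  have h2 : ‖sphereFluxDeriv e e₁ e₂ t z Vy V'‖ ^ 2 ≤ (t / capHeight t z * (‖Vy‖ + t * ‖V'‖)) ^ 2 :=
    pow_le_pow_left₀ h0 h 2
  have h3 : (‖Vy‖ + t * ‖V'‖) ^ 2 ≤ 2 * ‖Vy‖ ^ 2 + 2 * (t * ‖V'‖) ^ 2 := by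
    nlinarith [sq_nonneg (‖Vy‖ - t * ‖V'‖)]
  calc ‖sphereFluxDeriv e e₁ e₂ t z Vy V'‖ ^ 2 ≤ (t / capHeight t z * (‖Vy‖ + t * ‖V'‖)) ^ 2 := h2
    _ = (t / capHeight t z) ^ 2 * (‖Vy‖ + t * ‖V'‖) ^ 2 := by ring
    _ ≤ (t / capHeight t z) ^ 2 * (2 * ‖Vy‖ ^ 2 + 2 * (t * ‖V'‖) ^ 2) :=
        mul_le_mul_of_nonneg_left h3 (sq_nonneg _)

/-! ## Continuity of the derivatives on the open chart disc -/

/-- `capHeightDeriv t` is continuous on the open chart disc `‖z‖ < t`. [folklore] -/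
theorem continuousOn_capHeightDeriv (t : ℝ) : ContinuousOn (capHeightDeriv t) (Metric.ball (0 : ℂ) t) := by
  have h1 : ContinuousOn (fun z : ℂ => -(capHeight t z)⁻¹) (Metric.ball (0 : ℂ) t) :=
    ((continuous_capHeight t).continuousOn.inv₀ fun z hz => (capHeight_pos (mem_ball_zero_iff.1 hz)).ne').neg
  exact h1.smul (innerSL ℝ : ℂ →L[ℝ] ℂ →L[ℝ] ℝ).continuous.continuousOn

/-- The chart derivative is continuous on the open chart disc `‖z‖ < t`. [folklore] -/
theorem continuousOn_sphereChartDeriv (e e₁ e₂ : (EuclideanSpace ℝ (Fin 3))) (t : ℝ) :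
    ContinuousOn (sphereChartDeriv e e₁ e₂ t) (Metric.ball (0 : ℂ) t) := by
  have h : sphereChartDeriv e e₁ e₂ t =
      fun z => discChartL e₁ e₂ + (ContinuousLinearMap.toSpanSingleton ℝ e).comp (capHeightDeriv t z) := by
    funext z
    rw [ContinuousLinearMap.toSpanSingleton_comp]
    rfl
  rw [h]
  exact continuousOn_const.add (continuousOn_const.clm_comp (continuousOn_capHeightDeriv t))

/-- The flux derivative along `V` is continuous on the open chart disc, for continuous `V`, `V'`. [folklore] -/
theorem continuousOn_sphereFluxDeriv {V : (EuclideanSpace ℝ (Fin 3)) → (EuclideanSpace ℝ (Fin 3))}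
    {V' : (EuclideanSpace ℝ (Fin 3)) → (EuclideanSpace ℝ (Fin 3)) →L[ℝ] (EuclideanSpace ℝ (Fin 3))}
    (hVc : Continuous V) (hV'c : Continuous V') (e e₁ e₂ : (EuclideanSpace ℝ (Fin 3))) (t : ℝ) :
    ContinuousOn (fun z => sphereFluxDeriv e e₁ e₂ t z (V (sphereChart e e₁ e₂ t z)) (V' (sphereChart e e₁ e₂ t z)))
      (Metric.ball (0 : ℂ) t) := by
  have hφ := continuous_sphereChart e e₁ e₂ t
  have hD := continuousOn_sphereChartDeriv e e₁ e₂ t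
  have h1 : ContinuousOn (fun z => (innerSL ℝ (V (sphereChart e e₁ e₂ t z))).comp (sphereChartDeriv e e₁ e₂ t z))
      (Metric.ball (0 : ℂ) t) :=
    ((innerSL ℝ).continuous.comp (hVc.comp hφ)).continuousOn.clm_comp hD
  have h2 : ContinuousOn (fun z => (innerSL ℝ (sphereChart e e₁ e₂ t z)).comp
      ((V' (sphereChart e e₁ e₂ t z)).comp (sphereChartDeriv e e₁ e₂ t z))) (Metric.ball (0 : ℂ) t) :=
    ((innerSL ℝ).continuous.comp hφ).continuousOn.clm_comp ((hV'c.comp hφ).continuousOn.clm_comp hD)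
  exact h1.add h2

/-! ## Surjectivity onto the hemisphere and the six-cone cover -/

/-- The transversal coordinate of `y` in the frame: `⟪y, e₁⟫ + ⟪y, e₂⟫ i`. -/
noncomputable def transverseCoord (e₁ e₂ y : (EuclideanSpace ℝ (Fin 3))) : ℂ := ⟨⟪y, e₁⟫, ⟪y, e₂⟫⟩

/-- `‖transverseCoord e₁ e₂ y‖² = ⟪y,e₁⟫² + ⟪y,e₂⟫²`. [folklore] -/
theorem norm_transverseCoord_sq (e₁ e₂ y : (EuclideanSpace ℝ (Fin 3))) :
    ‖transverseCoord e₁ e₂ y‖ ^ 2 = ⟪y, e₁⟫ ^ 2 + ⟪y, e₂⟫ ^ 2 := by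
  rw [transverseCoord, Complex.sq_norm, Complex.normSq_apply]
  ring

/-- PARSEVAL in an orthonormal frame of `ℝ³`: `‖y‖² = ⟪y,e⟫² + ⟪y,e₁⟫² + ⟪y,e₂⟫²`. [folklore] -/
theorem norm_sq_eq_sum_frame (hon : Orthonormal ℝ ![e, e₁, e₂]) (y : (EuclideanSpace ℝ (Fin 3))) :
    ‖y‖ ^ 2 = ⟪y, e⟫ ^ 2 + ⟪y, e₁⟫ ^ 2 + ⟪y, e₂⟫ ^ 2 := by
  have hcard : Fintype.card (Fin 3) = Module.finrank ℝ (EuclideanSpace ℝ (Fin 3)) := by simp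
  have hspan : ⊤ ≤ Submodule.span ℝ (Set.range ![e, e₁, e₂]) := by
    rw [← coe_basisOfOrthonormalOfCardEqFinrank hon hcard]
    exact (basisOfOrthonormalOfCardEqFinrank hon hcard).span_eq.ge
  set b : OrthonormalBasis (Fin 3) ℝ (EuclideanSpace ℝ (Fin 3)) := OrthonormalBasis.mk hon hspan with hb
  have hb' : ⇑b = ![e, e₁, e₂] := OrthonormalBasis.coe_mk _ _
  have h := b.sum_sq_norm_inner_right y
  rw [Fin.sum_univ_three, hb'] at h
  simp only [Matrix.cons_val_zero, Matrix.cons_val_one, Matrix.cons_val] at h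
  rw [← h, real_inner_comm e y, real_inner_comm e₁ y, real_inner_comm e₂ y]
  simp [Real.norm_eq_abs, sq_abs]

/-- Every `y` in the closed half-space `⟪y, e⟫ ≥ 0` is a chart point over its transversal coordinate at radius
`‖y‖`: `sphereChart e e₁ e₂ ‖y‖ (transverseCoord e₁ e₂ y) = y`. [folklore] -/
theorem sphereChart_transverseCoord (hon : Orthonormal ℝ ![e, e₁, e₂]) {y : (EuclideanSpace ℝ (Fin 3))} (hy : 0 ≤ ⟪y, e⟫) :
    sphereChart e e₁ e₂ ‖y‖ (transverseCoord e₁ e₂ y) = y := by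
  have hcard : Fintype.card (Fin 3) = Module.finrank ℝ (EuclideanSpace ℝ (Fin 3)) := by simp
  have hspan : ⊤ ≤ Submodule.span ℝ (Set.range ![e, e₁, e₂]) := by
    rw [← coe_basisOfOrthonormalOfCardEqFinrank hon hcard]
    exact (basisOfOrthonormalOfCardEqFinrank hon hcard).span_eq.ge
  set b : OrthonormalBasis (Fin 3) ℝ (EuclideanSpace ℝ (Fin 3)) := OrthonormalBasis.mk hon hspan with hb
  have hb' : ⇑b = ![e, e₁, e₂] := OrthonormalBasis.coe_mk _ _
  have hheight : capHeight ‖y‖ (transverseCoord e₁ e₂ y) = ⟪y, e⟫ := by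
    rw [capHeight, norm_transverseCoord_sq, norm_sq_eq_sum_frame hon y]
    have : ⟪y, e⟫ ^ 2 + ⟪y, e₁⟫ ^ 2 + ⟪y, e₂⟫ ^ 2 - (⟪y, e₁⟫ ^ 2 + ⟪y, e₂⟫ ^ 2) = ⟪y, e⟫ ^ 2 := by ring
    rw [this, Real.sqrt_sq hy]
  rw [sphereChart_eq, hheight, discChartL_apply]
  have hre : (transverseCoord e₁ e₂ y).re = ⟪y, e₁⟫ := rfl
  have him : (transverseCoord e₁ e₂ y).im = ⟪y, e₂⟫ := rfl
  rw [hre, him, ← add_assoc]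
  have hexp := b.sum_repr' y
  rw [Fin.sum_univ_three, hb'] at hexp
  simp only [Matrix.cons_val_zero, Matrix.cons_val_one, Matrix.cons_val] at hexp
  rw [real_inner_comm y e, real_inner_comm y e₁, real_inner_comm y e₂] at hexp
  exact hexp

/-- In a cone of cosine `1/√3` around `e` the transversal coordinate is short: `⟪y,e⟫² ≥ ‖y‖²/3` gives
`‖transverseCoord e₁ e₂ y‖² ≤ (2/3)‖y‖²`. [folklore] -/
theorem norm_transverseCoord_sq_le (hon : Orthonormal ℝ ![e, e₁, e₂]) {y : (EuclideanSpace ℝ (Fin 3))}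
    (hy : ‖y‖ ^ 2 / 3 ≤ ⟪y, e⟫ ^ 2) : ‖transverseCoord e₁ e₂ y‖ ^ 2 ≤ 2 / 3 * ‖y‖ ^ 2 := by
  rw [norm_transverseCoord_sq]
  have h := norm_sq_eq_sum_frame hon y
  linarith

/-- SIX-CONE COVER: in an orthonormal frame some coordinate carries a third of `‖y‖²`. [folklore: pigeonhole] -/
theorem exists_inner_sq_ge (hon : Orthonormal ℝ ![e, e₁, e₂]) (y : (EuclideanSpace ℝ (Fin 3))) :
    ‖y‖ ^ 2 / 3 ≤ ⟪y, e⟫ ^ 2 ∨ ‖y‖ ^ 2 / 3 ≤ ⟪y, e₁⟫ ^ 2 ∨ ‖y‖ ^ 2 / 3 ≤ ⟪y, e₂⟫ ^ 2 := by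
  have h := norm_sq_eq_sum_frame hon y
  by_contra hcon
  simp only [not_or, not_le] at hcon
  obtain ⟨h0, h1, h2⟩ := hcon
  linarith

end Frame
end Summit.NavierStokesRegularity.NavierStokesRegularity.Theorems.PowerGaugeEulerLiouville.NeedleSphereChart
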